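import Summits.QuantumFields.YangMills.Theorems.BalabanUVNodesN15KingModelAnalyticDeterminantResponse
import Mathlib.MeasureTheory.Integral.IntervalIntegral.FundThmCalculus
import Mathlib.Topology.Instances.Matrix
import HarnessLib

/-!
# BalabanUVNodes ∕ N15 — THE KING-MODEL RUNG (PART Ϭ-m): KING's TELESCOPING (3.94) IN THE LIMIT — THE EXACT FIRST-ORDER FORMULA `ln det Δ_eff(U) − ln det Δ_eff(V) = ∫₀¹ tr(Δ_t⁻¹E) dt`,
# `Δ_t = Δ_eff(V) + t(Δ_eff(U) − Δ_eff(V))`, `E = Δ_eff(U) − Δ_eff(V)`, for any two real-orthogonal backgrounds (PART Ϭ-l's Jacobi derivative integrated by the fundamental theorem of calculus; the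
# integrand is continuous because the segment stays positive definite): King writes `ln[Z(A)Z(0)⁻¹]` as a sum of `R` increments along `(j∕R)A` ((3.94)) and expands each ((3.95)–(3.96)); here the
# operator is interpolated and `R → ∞` is the integral
# (Track A, DAG node N15 = NE2; FAN-OUT v1.1 §N15 s3 «KING-MODEL RUNG … + what the curved case adds»; count-neutral)

HONEST FRAMING.  Count-neutral (cell `pub-ymgap`, seat `pub-ymgap-dag-n15-e` g53; `--supports stmt-QuantumFields-27247 --as helper` = K3ᴬ, KEY MAP v3).  `𝕜 = ℝ` (real-orthogonal backgrounds), King's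
one-level comparison model, `a, m² > 0`, `c ≥ 0`, nonempty fibre; interpolation linear in the OPERATOR (King interpolates the field); NOT the loop expansion (3.96)–(3.98); NOT a node discharge (N15 of
record untouched); nothing continuum ∕ ℝ⁴ ∕ OS ∕ Clay.

THE RESULTS:
* §1 (generic, real matrices) `continuousAt_inv_affine` (`s ↦ (W + sE)⁻¹` is continuous where `det ≠ 0`; Mathlib `continuousAt_matrix_inv`), `continuousOn_trace_inv_affine_mul`,
  ★★★ **`integral_trace_inv_affine_mul_eq_log_det_sub`** (`det(W + sE) ≠ 0` on `[0,1]` ⟹ `∫₀¹ tr((W+sE)⁻¹E) ds = ln|det(W+E)| − ln|det W|` — FTC on PART Ϭ-l's `hasDerivAt_log_det_affine`).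
* §2 ★★★★ **`log_det_effLapU_sub_eq_integral_trace`** (`ln det Δ_eff(U) − ln det Δ_eff(V) = ∫₀¹ tr(Δ_t⁻¹(Δ_eff(U) − Δ_eff(V))) dt` for any two real-orthogonal backgrounds — the exact version of
  PART Ϭ-f's sandwich and of King's telescoping (3.94)).
PRIOR TREE ART (by name): Ϭ-l (`hasDerivAt_log_det_affine`, `posDef_effLapU_segment`), Mathlib (`intervalIntegral.integral_eq_sub_of_hasDerivAt`, `continuousAt_matrix_inv`, `Ring.inverse_eq_inv'`, `continuousAt_inv₀`,
`ContinuousOn.intervalIntegrable`).  Dedup (rg at filing): basename 0 files; needles `integral_trace_inv_affine_mul_eq_log_det_sub|log_det_effLapU_sub_eq_integral_trace|continuousAt_inv_affine` 0 tree files.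
Locators: [King1986] (3.94)–(3.96) p.669, (3.89)–(3.90) pp.668–669, (2.14) p.653; [HornJohnson2013] 0.8.10 eq. (0.8.10.1).  0 `sorry`, 0 `def`.
-/

noncomputable section
open scoped BigOperators ComplexConjugate ComplexOrder Matrix.Norms.L2Operator
open Finset Matrix MeasureTheory intervalIntegral

namespace Summit.QuantumFields.YangMills.BalabanUVNodes.N15KingModelRung.Analytic

open Literature.MathematicalPhysics.QuantumFieldTheory.Balaban1983to89.B5Prop11Plancherel (Tor fine)
open Summit.QuantumFields.YangMills.BalabanUVNodes.N15KingModelRung.CovariantBlock (BlockTree effLapU)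

/-! ## §1 Continuity of the integrand and the fundamental theorem of calculus -/

section Generic

variable {ι : Type*} [Fintype ι] [DecidableEq ι]

/-- `s ↦ (W + sE)⁻¹` is continuous at every `t` with `det(W + tE) ≠ 0`. [folklore] -/
theorem continuousAt_inv_affine (W E : Matrix ι ι ℝ) {t : ℝ} (hA : (W + t • E).det ≠ 0) : ContinuousAt (fun s : ℝ => (W + s • E)⁻¹) t := by
  have hpath : Continuous (fun s : ℝ => W + s • E) := continuous_const.add (continuous_id.smul continuous_const)
  have hinv : ContinuousAt Inv.inv (W + t • E) :=
    continuousAt_matrix_inv _ (by rw [Ring.inverse_eq_inv']; exact continuousAt_inv₀ hA)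
  exact ContinuousAt.comp (g := Inv.inv) hinv hpath.continuousAt

/-- The integrand `s ↦ tr((W + sE)⁻¹E)` is continuous on any set where `det(W + sE) ≠ 0`. [folklore] -/
theorem continuousOn_trace_inv_affine_mul (W E : Matrix ι ι ℝ) {S : Set ℝ} (hS : ∀ s ∈ S, (W + s • E).det ≠ 0) :
    ContinuousOn (fun s : ℝ => ((W + s • E)⁻¹ * E).trace) S := by
  refine fun t ht => ContinuousAt.continuousWithinAt ?_
  have h1 : ContinuousAt (fun s : ℝ => (W + s • E)⁻¹ * E) t := (continuousAt_inv_affine W E (hS t ht)).mul continuousAt_const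
  exact (continuous_id.matrix_trace.continuousAt).comp h1

/-- ★★★ **THE FUNDAMENTAL THEOREM OF CALCULUS FOR `ln det` ALONG AN AFFINE PATH**: if `det(W + sE) ≠ 0` for all `s ∈ [0,1]` then `∫₀¹ tr((W+sE)⁻¹E) ds = ln|det(W+E)| − ln|det W|`.
[cite: HornJohnson2013, 0.8.10 eq. (0.8.10.1); King1986, (3.94)–(3.95) p.669] -/
theorem integral_trace_inv_affine_mul_eq_log_det_sub (W E : Matrix ι ι ℝ) (hS : ∀ s ∈ Set.Icc (0 : ℝ) 1, (W + s • E).det ≠ 0) :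
    ∫ s in (0 : ℝ)..1, ((W + s • E)⁻¹ * E).trace = Real.log (W + E).det - Real.log W.det := by
  have huIcc : Set.uIcc (0 : ℝ) 1 = Set.Icc 0 1 := Set.uIcc_of_le zero_le_one
  have hderiv : ∀ s ∈ Set.uIcc (0 : ℝ) 1, HasDerivAt (fun s : ℝ => Real.log (W + s • E).det) (((W + s • E)⁻¹ * E).trace) s := by
    intro s hs
    rw [huIcc] at hs
    exact hasDerivAt_log_det_affine W E (hS s hs)
  have hint : IntervalIntegrable (fun s : ℝ => ((W + s • E)⁻¹ * E).trace) volume 0 1 := by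
    refine ContinuousOn.intervalIntegrable ?_
    rw [huIcc]
    exact continuousOn_trace_inv_affine_mul W E hS
  have h := intervalIntegral.integral_eq_sub_of_hasDerivAt hderiv hint
  simp only [one_smul, zero_smul, add_zero] at h
  exact h

end Generic

/-! ## §2 The exact first-order formula for King's block-field normalisation -/

section Model

variable {d : ℕ} {L : ℕ} [NeZero L] (T : BlockTree d L) (M : Fin (d + 1) → ℕ) [hM : ∀ μ, NeZero (M μ)]
variable {n : Type*} [Fintype n] [DecidableEq n] [Nonempty n]
variable {a c m2 : ℝ} (ha : 0 < a) (hc : 0 ≤ c) (hm : 0 < m2)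
variable {U V : Tor (fine L M) × Fin (d + 1) → Matrix n n ℝ} (hU : ∀ bd, U bd ∈ Matrix.unitaryGroup n ℝ) (hV : ∀ bd, V bd ∈ Matrix.unitaryGroup n ℝ)
include ha hc hm hU hV

/-- ★★★★ **KING's TELESCOPING (3.94) IN THE LIMIT — THE EXACT FIRST-ORDER FORMULA**: for any two real-orthogonal backgrounds,
`ln det Δ_eff(U) − ln det Δ_eff(V) = ∫₀¹ tr((Δ_eff(V) + t(Δ_eff(U) − Δ_eff(V)))⁻¹·(Δ_eff(U) − Δ_eff(V))) dt` (the segment stays positive definite, PART Ϭ-l).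
[cite: King1986, (3.94)–(3.96) p.669, (3.89)–(3.90) pp.668–669, (2.14) p.653; HornJohnson2013, 0.8.10 eq. (0.8.10.1)] -/
theorem log_det_effLapU_sub_eq_integral_trace :
    Real.log (effLapU T M a c m2 U).det - Real.log (effLapU T M a c m2 V).det
      = ∫ t in (0 : ℝ)..1, ((effLapU T M a c m2 V + t • (effLapU T M a c m2 U - effLapU T M a c m2 V))⁻¹ * (effLapU T M a c m2 U - effLapU T M a c m2 V)).trace := by
  have h := integral_trace_inv_affine_mul_eq_log_det_sub (effLapU T M a c m2 V) (effLapU T M a c m2 U - effLapU T M a c m2 V)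
    (fun s hs => (posDef_effLapU_segment T M ha hc hm hU hV hs).det_pos.ne')
  rw [add_sub_cancel] at h
  exact h.symm

end Model

end Summit.QuantumFields.YangMills.BalabanUVNodes.N15KingModelRung.Analytic

end
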